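import Summits.Ventures.HSemireg.WedgeHankelRecurrenceTracePowers
import Summits.Ventures.HSemireg.WedgeHankelRecurrenceDistinctRoots

/-!
# Venture HSemireg — THE NUMBER OF DISTINCT EIGENVALUES OF A MATRIX IS THE RANK OF ITS TRACE-POWER HANKEL MATRIX: for a square matrix `A` of size `t + 1` over a field `K`,
# **`(Tr(A^{i+j}))_{i,j ≤ t} = H_t(χ_A′/χ_A)`** (N114: `Tr(A^j)` is the `j`-th Newton sum of `χ_A`), hence in characteristic `0` **`rank (Tr(A^{i+j})) = #{distinct eigenvalues of A}`** (in any field where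
# `χ_A` splits; N110), in every characteristic `= #{eigenvalues whose algebraic multiplicity is non-zero in K}`, and **`det (Tr(A^{i+j})) = disc(χ_A)`**, non-zero iff `χ_A` is separable
# (`A` has `t + 1` distinct eigenvalues) — «the discriminant of a matrix» (N95 ∕ N96 for `χ_A`).

HONEST FRAMING. Part of the Lean index of the computation cell `pub-hsemireg` (seat p10 gen 32, Sunday typer «UNIFORM-IN-n»).
LINEAR ALGEBRA OF HANKEL (catalecticant) MATRICES and of polynomials over a field ONLY (`Matrix.trace`, `Matrix.charpoly`, `Polynomial.discr`, the lineage's `hankelSq` ∕ `dualSeq`): no variety, no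
cohomology theory, no sheaf, no Ext group and no semiregularity map is constructed here; «eigenvalue» = root of `χ_A` in a splitting field (dictionary); nothing here says that HC / HC_CM / HC_AV
holds; no Literature fact is declared or used.  Custodian versions as in `WedgeHankelSiegelIdeal` (1/3).

WHAT IS IN THE TREE.  N114 (`WedgeHankelRecurrenceTracePowers`): `trace_pow_eq_dualSeq_charpoly_derivative` (`Tr(A^j) = dualSeq χ_A χ_A′ j`, every field).  N110 (`WedgeHankelRecurrenceDistinctRoots`):
`rank_hankelSq_dualSeq_derivative_eq_card_roots_toFinset_map` (characteristic `0`), `rank_hankelSq_dualSeq_derivative_eq_card_filter_map` (every characteristic), `rank_hankelSq_dualSeq_derivative_eq_natDegree_radical`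
(`= deg rad`, characteristic `0`).  N95: `det_hankelSq_dualSeq_derivative` (`det H_t(p′/p) = disc p`).  N96: `det_hankelSq_dualSeq_derivative_ne_zero_iff` (`≠ 0 ⟺ p.Separable`).  PROVED Literature
`LinearAlgebra/Matrix/TracePowersDetermineCharpoly` (traces of powers DETERMINE `χ_A`, characteristic `0`) and `Algebra/Polynomial/HermiteRankSignature` (Hankel matrix of Newton sums of a REAL
polynomial) — not imported.
DEDUP ∕ HONESTY: THE COMPLEX CASE IS ALREADY PROVED LITERATURE: `Literature/LinearAlgebra/Matrix/MomentMatrixRank.lean` (Horn–Johnson *Matrix Analysis* § 2.4 Problem 2.4.P22: for `A ∈ M_n(ℂ)`,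
`rank [tr A^{i+j}] = number of distinct eigenvalues`, via `K = V D Vᵀ` on the distinct eigenvalues and Vandermonde ranks) and `…/MomentMatrixDiscriminant.lean` (2.4.P21: `K = VVᵀ`,
`det K = ∏_{i<j} (λ_j − λ_i)²` = the discriminant of `A`, nonsingular iff the eigenvalues are distinct) — both for `Matrix (Fin n) (Fin n) ℂ` ∕ `Matrix n n ℂ`, eigenvalue ∕ Schur route; found by
`rg -i 'distinct eigenvalues'`; not imported.  THIS file is the same statement over an ARBITRARY field (characteristic `0` for the distinct-eigenvalue count, every characteristic for the count with
multiplicities non-zero in `K`, and `det = Polynomial.discr χ_A` ∕ `≠ 0 ⟺ χ_A.Separable` with no splitting assumption), by the lineage's algebraic route (N114 + N110's `gcd(χ, χ′)` multiplicities),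
in the lineage's `hankelSq` vocabulary — a generalisation ∕ dictionary leaf, no novelty over Horn–Johnson for `ℂ` claimed.  Mathlib: `Matrix.charpoly_natDegree_eq_dim`, `Matrix.charpoly_monic`.
THIS FILE (namespace `Summit.Ventures.HSemireg.Wedge.HankelOuter` continued; PLAIN on N114 + N110 once both are in the TREE; 0 definitions):
* §703 **`hankelSq_trace_pow`** (`hankelSq t (j ↦ Tr(A^j)) = H_t(χ_A′/χ_A)`), **`rank_hankelSq_trace_pow_eq_card_roots_charpoly`** (characteristic `0`: `= #distinct roots of φχ_A` — the distinct eigenvalues),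
  `rank_hankelSq_trace_pow_eq_card_filter` (every characteristic), `rank_hankelSq_trace_pow_eq_natDegree_radical` (characteristic `0`: `= deg rad χ_A`), **`det_hankelSq_trace_pow`** (`= disc χ_A`),
  **`det_hankelSq_trace_pow_ne_zero_iff`** (`≠ 0 ⟺ χ_A.Separable`).
Nothing Ext-side.  New names only.
-/

open Module Polynomial
open scoped Matrix Polynomial

namespace Summit.Ventures.HSemireg.Wedge.HankelOuter

open Summit.Ventures.HSemireg.Wedge Summit.Ventures.HSemireg.Wedge.Hankel

variable (K : Type*) [Field K]

/-! ## §703. The trace-power Hankel matrix of a square matrix -/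

/-- **`(Tr(A^{i+j}))_{i,j ≤ t} = H_t(χ_A′/χ_A)`**: the Hankel matrix of the traces of the powers of `A` is the Hankel matrix of the Newton sums of its characteristic polynomial (N114; any square
matrix over any field, any `t`). -/
theorem hankelSq_trace_pow {ι : Type*} [Fintype ι] [DecidableEq ι] (A : Matrix ι ι K) (t : ℕ) :
    hankelSq K t (fun j => (A ^ j).trace) = hankelSq K t (dualSeq K A.charpoly (derivative A.charpoly)) := by
  ext i j
  simp only [hankelSq, Matrix.of_apply, trace_pow_eq_dualSeq_charpoly_derivative]

/-- **THE NUMBER OF DISTINCT EIGENVALUES (characteristic `0`): `rank (Tr(A^{i+j}))_{i,j ≤ t} = #{distinct roots of χ_A in L}`** for a square matrix `A` of size `t + 1` and any embedding `φ : K → L`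
into a field of characteristic `0` over which `χ_A` splits. -/
theorem rank_hankelSq_trace_pow_eq_card_roots_charpoly [DecidableEq K] {L : Type*} [Field L] [DecidableEq L] [CharZero L] (φ : K →+* L) {ι : Type*} [Fintype ι] [DecidableEq ι] {t : ℕ}
    (hι : Fintype.card ι = t + 1) (A : Matrix ι ι K) (hs : (A.charpoly.map φ).Splits) :
    (hankelSq K t (fun j => (A ^ j).trace)).rank = (A.charpoly.map φ).roots.toFinset.card := by
  rw [hankelSq_trace_pow]
  exact rank_hankelSq_dualSeq_derivative_eq_card_roots_toFinset_map K φ A.charpoly_monic (by rw [Matrix.charpoly_natDegree_eq_dim, hι]) hs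

/-- Every characteristic: `rank (Tr(A^{i+j}))_{i,j ≤ t}` = the number of distinct eigenvalues whose ALGEBRAIC MULTIPLICITY is non-zero in the field (`A` of size `t + 1`, `φ` splitting `χ_A`). -/
theorem rank_hankelSq_trace_pow_eq_card_filter [DecidableEq K] {L : Type*} [Field L] [DecidableEq L] (φ : K →+* L) {ι : Type*} [Fintype ι] [DecidableEq ι] {t : ℕ} (hι : Fintype.card ι = t + 1)
    (A : Matrix ι ι K) (hs : (A.charpoly.map φ).Splits) :
    (hankelSq K t (fun j => (A ^ j).trace)).rank = ((A.charpoly.map φ).roots.toFinset.filter fun c => (((A.charpoly.map φ).roots.count c : ℕ) : L) ≠ 0).card := by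
  rw [hankelSq_trace_pow]
  exact rank_hankelSq_dualSeq_derivative_eq_card_filter_map K φ A.charpoly_monic (by rw [Matrix.charpoly_natDegree_eq_dim, hι]) hs

/-- Characteristic `0`, intrinsically: `rank (Tr(A^{i+j}))_{i,j ≤ t} = deg rad(χ_A)` (`A` of size `t + 1`; no splitting field). -/
theorem rank_hankelSq_trace_pow_eq_natDegree_radical [DecidableEq K] [CharZero K] {ι : Type*} [Fintype ι] [DecidableEq ι] {t : ℕ} (hι : Fintype.card ι = t + 1) (A : Matrix ι ι K) :
    (hankelSq K t (fun j => (A ^ j).trace)).rank = (UniqueFactorizationMonoid.radical A.charpoly).natDegree := by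
  rw [hankelSq_trace_pow]
  exact rank_hankelSq_dualSeq_derivative_eq_natDegree_radical K A.charpoly_monic (by rw [Matrix.charpoly_natDegree_eq_dim, hι])

/-- **«THE DISCRIMINANT OF A MATRIX»: `det (Tr(A^{i+j}))_{i,j ≤ t} = disc(χ_A)`** (`A` of size `t + 1`, any field; N95 for `χ_A`). -/
theorem det_hankelSq_trace_pow {ι : Type*} [Fintype ι] [DecidableEq ι] {t : ℕ} (hι : Fintype.card ι = t + 1) (A : Matrix ι ι K) :
    (hankelSq K t (fun j => (A ^ j).trace)).det = A.charpoly.discr := by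
  rw [hankelSq_trace_pow]
  exact det_hankelSq_dualSeq_derivative K A.charpoly_monic (by rw [Matrix.charpoly_natDegree_eq_dim, hι])

/-- **`det (Tr(A^{i+j}))_{i,j ≤ t} ≠ 0 ⟺ χ_A` is separable** (`A` of size `t + 1` has `t + 1` distinct eigenvalues in a splitting field; N96's Hermite criterion for `χ_A`). -/
theorem det_hankelSq_trace_pow_ne_zero_iff [DecidableEq K] {ι : Type*} [Fintype ι] [DecidableEq ι] {t : ℕ} (hι : Fintype.card ι = t + 1) (A : Matrix ι ι K) :
    (hankelSq K t (fun j => (A ^ j).trace)).det ≠ 0 ↔ A.charpoly.Separable := by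
  rw [hankelSq_trace_pow]
  exact det_hankelSq_dualSeq_derivative_ne_zero_iff K A.charpoly_monic (by rw [Matrix.charpoly_natDegree_eq_dim, hι])

end Summit.Ventures.HSemireg.Wedge.HankelOuter
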